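import Summits.AtomisticToContinuum.BoseEinsteinCondensation.Theses.BECPalmDirectCorrelation
import Summits.AtomisticToContinuum.BoseEinsteinCondensation.Theorems.BECConjugateDominationNearMinimiserStability
import Literature.MathematicalPhysics.QuantumManyBody.PeriodicGroundStateNondegenerateProofs
import HarnessLib

/-!
# Route `BECPalmDirectCorrelation`, support item `StructureFactorFloor` (stmt-AtomisticToContinuum-12228):
# `L²`-rigidity of near-minimisers and the Lipschitz bound for `√(N S_m)`

Supports (does not close) stmt-AtomisticToContinuum-12228
(`Summit.AtomisticToContinuum.BoseEinsteinCondensation.Theses.BECPalmDirectCorrelation.StructureFactorFloor`):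
the two transfer tools that carry ANY floor on the cell structure factor
`S_m(Ψ) = N⁻¹ ∫_{cell^N} |∑ⱼ e_m(xⱼ)|² |Ψ|²` from an exact minimiser to all `δ`-near-minimisers at fixed
`(N, L)` (the item's "sup form is robust since `√(N S_m)` is Lipschitz in `L²`"), used by
`BECPalmDirectCorrelationStructureFactorFloorSolidCore.lean`.

* `exists_phase_lintegral_sub_sq_le` — **`L²`-rigidity of near-minimisers up to a phase**: for a measurable
  pair profile with bounded periodisation, `N = n+1 ≥ 1`, `L > 0` and `η > 0` there is `δ > 0` such that
  every exact minimiser `Ψ` and every `δ`-near-minimiser `Φ` of the periodic energy satisfy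
  `∫_{cell^N}|Ψ - cΦ|² ≤ η²` for a phase `c` (simple bosonic ground state
  `PeriodicGroundStateNondegenerate_holds` [ReedSimonIV1978, §XIII.12], min–max gap inequality and phase
  alignment as in `nearMinimiserStability_of_nondegenerate` [ReedSimonIV1978, Thm. XIII.1]).
* `rpow_lintegral_weight_sq_le`, `sqrt_toReal_lintegral_weight_sq_le`, `sqrt_weightMoment_le` —
  **Minkowski with a bounded weight**: `√(∫|ρ_m|²|Ψ|²) ≤ √(∫|ρ_m|²|Φ|²) + N√(∫|Ψ - cΦ|²)`.
* small facts: `|ρ_m| ≤ N`, the moments are `≤ N²`, Bochner = `ℝ≥0∞` form of the moment, lattice-vector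
  norms (`‖latticeVec c m‖ = c‖latticeVec 1 m‖`, `‖latticeVec 1 m‖ ≥ 1` for `m ≠ 0`), and the floor
  profile `x ↦ x/√(x² + a)` (monotone in `x`, antitone in `a`, `≥ ½ min(x/√a, 1)`).
-/

noncomputable section

namespace Summit.AtomisticToContinuum.BoseEinsteinCondensation.Theorems

open MeasureTheory Filter Set Complex
open scoped ENNReal NNReal Topology ComplexConjugate InnerProductSpace BigOperators
open Literature.MathematicalPhysics.QuantumManyBody.BoseGas Literature.Analysis.InnerProduct
open Literature.MathematicalPhysics.QuantumManyBody (PeriodicGroundStateNondegenerate_holds)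

namespace StructureFactorFloor

/-! ### 1. `L²`-rigidity of near-minimisers up to a phase (fixed `N`, `L`) -/

/-- **Near-minimisers are `L²`-close to the minimiser up to a phase.** For a measurable pair profile `v`
with bounded periodisation on the torus of side `L > 0`, `N = n+1` bosons and `η > 0`, there is `δ > 0`
such that every exact minimiser `Ψ` and every `δ`-near-minimiser `Φ` of the periodic energy satisfy
`∫_{cell^N} |Ψ - cΦ|² ≤ η²` for some phase `c`, `|c| = 1`. Proof: min–max in the form domain
(`TwoModeData` of `formEmbed`), the gap `E₀ < E₁` of the simple bosonic ground state
(`PeriodicGroundStateNondegenerate_holds`), the gap inequality and phase alignment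
(`twoModeData_exists_phase_norm_sub_sq_le`) with `δ = (E₁ - E₀)η²/2`.
[cite: ReedSimonIV1978, Thm. XIII.1 and §XIII.12] -/
theorem exists_phase_lintegral_sub_sq_le {v : ℝ → ℝ≥0∞} {L : ℝ} (hL : 0 < L) (hmeas : Measurable v)
    {C : ℝ≥0} (hC : ∀ x, periodizedPotential v L x ≤ C) (n : ℕ) {η : ℝ} (hη : 0 < η) :
    ∃ δ : ℝ≥0∞, 0 < δ ∧ ∀ Ψ Φ : PeriodicTrialState (n + 1) L,
      periodicEnergy v Ψ = periodicGroundStateEnergy v (n + 1) L →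
      periodicEnergy v Φ ≤ periodicGroundStateEnergy v (n + 1) L + δ →
      ∃ c : ℂ, ‖c‖ = 1 ∧
        ∫⁻ X in cellN (n + 1) L, (‖Ψ.ψ X - c * Φ.ψ X‖₊ : ℝ≥0∞) ^ 2 ≤ ENNReal.ofReal (η ^ 2) := by
  have hW : ∫⁻ X in cellN (n + 1) L, periodicInteraction v L X ≠ ⊤ :=
    lintegral_periodicInteraction_ne_top hC (n + 1)
  -- the graph map into the form domain `Q` and the embedding `ι : Q → H = L²`
  set J := (graphEmbed hL hmeas hW).codRestrict (formDomain hL hmeas hW)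
    (graphEmbed_mem_formDomain hL hmeas hW) with hJ
  have hJapply : ∀ F : periodicCore (n + 1) L,
      J F = ⟨graphEmbed hL hmeas hW F, graphEmbed_mem_formDomain hL hmeas hW F⟩ := fun F => rfl
  set ι := formEmbed hL hmeas hW with hι
  -- spectral data of the two lowest eigenvalues, and the gap
  obtain ⟨d⟩ := nonempty_twoModeData hL hmeas hW (Nat.succ_pos n)
  have hE₀ : periodicGroundStateEnergy v (n + 1) L = ENNReal.ofReal (d.κ₁⁻¹ - 1) :=
    periodicGroundStateEnergy_eq_ofReal d
  have h1 : 1 ≤ d.κ₁⁻¹ := twoModeData_one_le_inv_κ₁ d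
  have hgap : d.κ₁⁻¹ < d.κ₂⁻¹ := by
    have hlt := PeriodicGroundStateNondegenerate_holds (n + 1) L v (Nat.succ_pos n) hL hmeas ⟨C, hC⟩
    rw [hE₀, kyFanTwo_eq_ofReal d,
      show (2 : ℝ≥0∞) * ENNReal.ofReal (d.κ₁⁻¹ - 1) = ENNReal.ofReal (2 * (d.κ₁⁻¹ - 1)) by
        rw [ENNReal.ofReal_mul zero_le_two, ENNReal.ofReal_ofNat],
      ENNReal.ofReal_lt_ofReal_iff_of_nonneg (by linarith)] at hlt
    linarith
  have hg0 : 0 < d.κ₂⁻¹ - d.κ₁⁻¹ := sub_pos.2 hgap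
  refine ⟨ENNReal.ofReal ((d.κ₂⁻¹ - d.κ₁⁻¹) * (η ^ 2 / 2)),
    ENNReal.ofReal_pos.2 (by positivity), fun Ψ Φ hΨ hΦ => ?_⟩
  -- the vectors
  set FΨ : periodicCore (n + 1) L := ⟨Ψ.ψ, Ψ.mem_periodicCore⟩ with hFΨ
  set FΦ : periodicCore (n + 1) L := ⟨Φ.ψ, Φ.mem_periodicCore⟩ with hFΦ
  have huΨ : ‖ι (J FΨ)‖ = 1 := norm_formEmbed_graphEmbed_trialState hL hmeas hW Ψ
  have huΦ : ‖ι (J FΦ)‖ = 1 := norm_formEmbed_graphEmbed_trialState hL hmeas hW Φ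
  have hnormJ : ∀ F : periodicCore (n + 1) L, ‖J F‖ = ‖graphEmbed hL hmeas hW F‖ := fun F => by
    rw [hJapply]; rfl
  have hQΨ : ‖J FΨ‖ ^ 2 = 1 + (periodicEnergy v Ψ).toReal := by
    rw [hnormJ]; exact norm_graphEmbed_sq_trialState hL hmeas hW Ψ
  have hQΦ : ‖J FΦ‖ ^ 2 = 1 + (periodicEnergy v Φ).toReal := by
    rw [hnormJ]; exact norm_graphEmbed_sq_trialState hL hmeas hW Φ
  -- energies as real numbers
  have hEΨ : (periodicEnergy v Ψ).toReal = d.κ₁⁻¹ - 1 := by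
    rw [hΨ, hE₀, ENNReal.toReal_ofReal (by linarith)]
  have hEΦ : (periodicEnergy v Φ).toReal ≤ d.κ₁⁻¹ - 1 + (d.κ₂⁻¹ - d.κ₁⁻¹) * (η ^ 2 / 2) := by
    rw [hE₀, ← ENNReal.ofReal_add (by linarith) (by positivity)] at hΦ
    have := ENNReal.toReal_mono ENNReal.ofReal_ne_top hΦ
    rwa [ENNReal.toReal_ofReal (by nlinarith [sq_nonneg η])] at this
  -- the abstract stability argument: `‖ιΨ - c•ιΦ‖² ≤ η²`
  obtain ⟨c, hc, hdist⟩ := twoModeData_exists_phase_norm_sub_sq_le (ι := ι) d hgap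
    (u := J FΨ) (w := J FΦ) huΨ huΦ (t := η ^ 2) (by linarith) (by linarith)
  -- back to functions on the cell
  have hcore : ι (J FΨ) - c • ι (J FΦ) = ι (J (FΨ - c • FΦ)) := by
    simp only [map_sub, map_smul]
  have hfun : ((FΨ - c • FΦ : periodicCore (n + 1) L) : Config (n + 1) → ℂ) =
      fun X => Ψ.ψ X - c * Φ.ψ X := by
    ext X
    simp [hFΨ, hFΦ]
  have hcontd : Continuous fun X => Ψ.ψ X - c * Φ.ψ X :=
    Ψ.contDiff.continuous.sub (continuous_const.mul Φ.contDiff.continuous)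
  refine ⟨c, hc, ?_⟩
  have hnorm : ‖ι (J (FΨ - c • FΦ))‖ ^ 2 =
      (∫⁻ X in cellN (n + 1) L,
        (‖((FΨ - c • FΦ : periodicCore (n + 1) L) : Config (n + 1) → ℂ) X‖₊ : ℝ≥0∞) ^ 2).toReal :=
    norm_formEmbed_graphEmbed_sq hL hmeas hW (FΨ - c • FΦ)
  simp only [hfun, ← hcore] at hnorm
  have hfin' : (∫⁻ X in cellN (n + 1) L, (‖Ψ.ψ X - c * Φ.ψ X‖₊ : ℝ≥0∞) ^ 2) ≠ ⊤ :=
    (lintegral_cellN_sq_lt_top L hcontd).ne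
  rw [← ENNReal.ofReal_toReal hfin', ← hnorm]
  exact ENNReal.ofReal_le_ofReal hdist

/-! ### 2. Weighted second moments are Lipschitz in `L²` (Minkowski) -/

/-- **Minkowski with a bounded weight.** For a measurable weight `w ≤ W < ∞` and a.e.-measurable
`f, g`: `(∫ w²|f|²)^{1/2} ≤ (∫ w²|g|²)^{1/2} + W (∫ |f - g|²)^{1/2}` (`|f| ≤ |g| + |f - g|` pointwise,
Minkowski in `L²(μ)`, `w|f - g| ≤ W|f - g|`). [folklore] -/
theorem rpow_lintegral_weight_sq_le {α : Type*} [MeasurableSpace α] (μ : Measure α)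
    {w : α → ℝ≥0∞} (hw : Measurable w) {W : ℝ≥0∞} (hwW : ∀ x, w x ≤ W) (hWtop : W ≠ ⊤)
    {f g : α → ℂ} (hf : AEMeasurable f μ) (hg : AEMeasurable g μ) :
    (∫⁻ x, w x ^ 2 * (‖f x‖₊ : ℝ≥0∞) ^ 2 ∂μ) ^ (1 / 2 : ℝ) ≤
      (∫⁻ x, w x ^ 2 * (‖g x‖₊ : ℝ≥0∞) ^ 2 ∂μ) ^ (1 / 2 : ℝ) +
        W * (∫⁻ x, (‖f x - g x‖₊ : ℝ≥0∞) ^ 2 ∂μ) ^ (1 / 2 : ℝ) := by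
  set F : α → ℝ≥0∞ := fun x => w x * ‖g x‖₊ with hF
  set G : α → ℝ≥0∞ := fun x => w x * ‖f x - g x‖₊ with hG
  have hF_meas : AEMeasurable F μ := hw.aemeasurable.mul hg.nnnorm.coe_nnreal_ennreal
  have hG_meas : AEMeasurable G μ := hw.aemeasurable.mul (hf.sub hg).nnnorm.coe_nnreal_ennreal
  have h1 : ∫⁻ x, w x ^ 2 * (‖f x‖₊ : ℝ≥0∞) ^ 2 ∂μ ≤ ∫⁻ x, (F + G) x ^ (2 : ℝ) ∂μ :=
    lintegral_mono fun x => by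
      rw [ENNReal.rpow_two, ← mul_pow, Pi.add_apply, hF, hG]
      gcongr
      rw [← mul_add]
      gcongr
      exact_mod_cast nnnorm_le_insert' (f x) (g x)
  have h2 := ENNReal.lintegral_Lp_add_le (μ := μ) hF_meas hG_meas one_le_two
  have htop : W ^ 2 ≠ ⊤ := ENNReal.pow_ne_top hWtop
  have h3 : ∫⁻ x, G x ^ (2 : ℝ) ∂μ ≤ W ^ 2 * ∫⁻ x, (‖f x - g x‖₊ : ℝ≥0∞) ^ 2 ∂μ := by
    rw [← lintegral_const_mul' _ _ htop]
    refine lintegral_mono fun x => ?_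
    rw [ENNReal.rpow_two, hG, mul_pow]
    gcongr
    exact hwW x
  have h4 : ∫⁻ x, F x ^ (2 : ℝ) ∂μ = ∫⁻ x, w x ^ 2 * (‖g x‖₊ : ℝ≥0∞) ^ 2 ∂μ :=
    lintegral_congr fun x => by rw [ENNReal.rpow_two, hF, mul_pow]
  have h5 : (W ^ 2) ^ (1 / 2 : ℝ) = W := by
    rw [← ENNReal.rpow_two, ← ENNReal.rpow_mul]
    norm_num
  calc (∫⁻ x, w x ^ 2 * (‖f x‖₊ : ℝ≥0∞) ^ 2 ∂μ) ^ (1 / 2 : ℝ)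
      ≤ (∫⁻ x, (F + G) x ^ (2 : ℝ) ∂μ) ^ (1 / 2 : ℝ) := ENNReal.rpow_le_rpow h1 (by norm_num)
    _ ≤ (∫⁻ x, F x ^ (2 : ℝ) ∂μ) ^ (1 / 2 : ℝ) + (∫⁻ x, G x ^ (2 : ℝ) ∂μ) ^ (1 / 2 : ℝ) := h2
    _ ≤ (∫⁻ x, w x ^ 2 * (‖g x‖₊ : ℝ≥0∞) ^ 2 ∂μ) ^ (1 / 2 : ℝ) +
          W * (∫⁻ x, (‖f x - g x‖₊ : ℝ≥0∞) ^ 2 ∂μ) ^ (1 / 2 : ℝ) := by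
        rw [h4]
        gcongr ?_ + ?_
        · exact le_rfl
        · calc (∫⁻ x, G x ^ (2 : ℝ) ∂μ) ^ (1 / 2 : ℝ)
              ≤ (W ^ 2 * ∫⁻ x, (‖f x - g x‖₊ : ℝ≥0∞) ^ 2 ∂μ) ^ (1 / 2 : ℝ) :=
                ENNReal.rpow_le_rpow h3 (by norm_num)
            _ = W * (∫⁻ x, (‖f x - g x‖₊ : ℝ≥0∞) ^ 2 ∂μ) ^ (1 / 2 : ℝ) := by
                rw [ENNReal.mul_rpow_of_nonneg _ _ (by norm_num), h5]

/-- Real form of `rpow_lintegral_weight_sq_le` for finite moments: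
`√(∫ w²|f|²) ≤ √(∫ w²|g|²) + W √(∫ |f - g|²)` with real square roots of the (finite) `ℝ≥0∞` integrals.
[folklore] -/
theorem sqrt_toReal_lintegral_weight_sq_le {α : Type*} [MeasurableSpace α] (μ : Measure α)
    {w : α → ℝ≥0∞} (hw : Measurable w) {W : ℝ≥0} (hwW : ∀ x, w x ≤ W)
    {f g : α → ℂ} (hf : AEMeasurable f μ) (hg : AEMeasurable g μ)
    (hB : ∫⁻ x, w x ^ 2 * (‖g x‖₊ : ℝ≥0∞) ^ 2 ∂μ ≠ ⊤)
    (hD : ∫⁻ x, (‖f x - g x‖₊ : ℝ≥0∞) ^ 2 ∂μ ≠ ⊤) :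
    Real.sqrt (∫⁻ x, w x ^ 2 * (‖f x‖₊ : ℝ≥0∞) ^ 2 ∂μ).toReal ≤
      Real.sqrt (∫⁻ x, w x ^ 2 * (‖g x‖₊ : ℝ≥0∞) ^ 2 ∂μ).toReal +
        W * Real.sqrt (∫⁻ x, (‖f x - g x‖₊ : ℝ≥0∞) ^ 2 ∂μ).toReal := by
  have h := rpow_lintegral_weight_sq_le μ hw hwW ENNReal.coe_ne_top hf hg
  have hBr : (∫⁻ x, w x ^ 2 * (‖g x‖₊ : ℝ≥0∞) ^ 2 ∂μ) ^ (1 / 2 : ℝ) ≠ ⊤ :=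
    ENNReal.rpow_ne_top_of_nonneg (by norm_num) hB
  have hDr : (∫⁻ x, (‖f x - g x‖₊ : ℝ≥0∞) ^ 2 ∂μ) ^ (1 / 2 : ℝ) ≠ ⊤ :=
    ENNReal.rpow_ne_top_of_nonneg (by norm_num) hD
  have hrhs : (∫⁻ x, w x ^ 2 * (‖g x‖₊ : ℝ≥0∞) ^ 2 ∂μ) ^ (1 / 2 : ℝ) +
      (W : ℝ≥0∞) * (∫⁻ x, (‖f x - g x‖₊ : ℝ≥0∞) ^ 2 ∂μ) ^ (1 / 2 : ℝ) ≠ ⊤ :=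
    ENNReal.add_ne_top.2 ⟨hBr, ENNReal.mul_ne_top ENNReal.coe_ne_top hDr⟩
  have h' := ENNReal.toReal_mono hrhs h
  rw [ENNReal.toReal_add hBr (ENNReal.mul_ne_top ENNReal.coe_ne_top hDr), ENNReal.toReal_mul,
    ← ENNReal.toReal_rpow, ← ENNReal.toReal_rpow, ← ENNReal.toReal_rpow, ENNReal.coe_toReal] at h'
  simpa only [Real.sqrt_eq_rpow] using h'

/-! ### 3. Elementary facts: the density-wave weight, lattice vectors, the floor profile -/

variable {n : ℕ} {L : ℝ}

/-- The density wave `ρ_m(X) = ∑ⱼ e_m(xⱼ)` is continuous. [folklore] -/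
theorem continuous_densityWaveSum (L : ℝ) (m : Fin 3 → ℤ) :
    Continuous fun X : Config (n + 1) => ∑ j : Fin (n + 1), cellWave L m (X j) :=
  continuous_finsetSum _ fun j _ => (contDiff_cellWave L m).continuous.comp (continuous_apply j)

/-- `|ρ_m(X)| ≤ N`. [folklore] -/
theorem norm_densityWaveSum_le (L : ℝ) (m : Fin 3 → ℤ) (X : Config (n + 1)) :
    ‖∑ j : Fin (n + 1), cellWave L m (X j)‖ ≤ (n + 1 : ℕ) := by
  calc ‖∑ j : Fin (n + 1), cellWave L m (X j)‖ ≤ ∑ j : Fin (n + 1), ‖cellWave L m (X j)‖ :=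
        norm_sum_le _ _
    _ = (n + 1 : ℕ) := by simp [norm_cellWave]

/-- `|ρ_m(X)| ≤ N` in `ℝ≥0`. [folklore] -/
theorem nnnorm_densityWaveSum_le (L : ℝ) (m : Fin 3 → ℤ) (X : Config (n + 1)) :
    ‖∑ j : Fin (n + 1), cellWave L m (X j)‖₊ ≤ ((n + 1 : ℕ) : ℝ≥0) := by
  rw [← NNReal.coe_le_coe, coe_nnnorm, NNReal.coe_natCast]
  exact norm_densityWaveSum_le L m X

/-- `|ρ_m(X)| ≤ N` in `ℝ≥0∞`. [folklore] -/
theorem coe_nnnorm_densityWaveSum_le (L : ℝ) (m : Fin 3 → ℤ) (X : Config (n + 1)) :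
    ((‖∑ j : Fin (n + 1), cellWave L m (X j)‖₊ : ℝ≥0) : ℝ≥0∞) ≤ ((n + 1 : ℕ) : ℝ≥0) :=
  ENNReal.coe_le_coe.2 (nnnorm_densityWaveSum_le L m X)

/-- The weighted second moment `∫_{cell^N} |ρ_m|²|Ψ|²` of a normalised state is at most `N²`, in
particular finite. [folklore] -/
theorem lintegral_weight_sq_le (L : ℝ) (m : Fin 3 → ℤ) (Ψ : PeriodicTrialState (n + 1) L) :
    ∫⁻ X in cellN (n + 1) L, ((‖∑ j : Fin (n + 1), cellWave L m (X j)‖₊ : ℝ≥0∞)) ^ 2 *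
        (‖Ψ.ψ X‖₊ : ℝ≥0∞) ^ 2 ≤ (((n + 1 : ℕ) : ℝ≥0) : ℝ≥0∞) ^ 2 := by
  calc ∫⁻ X in cellN (n + 1) L, ((‖∑ j : Fin (n + 1), cellWave L m (X j)‖₊ : ℝ≥0∞)) ^ 2 *
        (‖Ψ.ψ X‖₊ : ℝ≥0∞) ^ 2
      ≤ ∫⁻ X in cellN (n + 1) L, (((n + 1 : ℕ) : ℝ≥0) : ℝ≥0∞) ^ 2 * (‖Ψ.ψ X‖₊ : ℝ≥0∞) ^ 2 := by
        refine lintegral_mono fun X => ?_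
        gcongr
        exact nnnorm_densityWaveSum_le L m X
    _ = (((n + 1 : ℕ) : ℝ≥0) : ℝ≥0∞) ^ 2 * ∫⁻ X in cellN (n + 1) L, (‖Ψ.ψ X‖₊ : ℝ≥0∞) ^ 2 := by
        rw [lintegral_const_mul' _ _ (ENNReal.pow_ne_top ENNReal.coe_ne_top)]
    _ = (((n + 1 : ℕ) : ℝ≥0) : ℝ≥0∞) ^ 2 := by rw [Ψ.norm_eq, mul_one]

/-- The Bochner form of the weighted second moment equals the real part of its `ℝ≥0∞` form:
`∫_{cell^N} |ρ_m|²|Ψ|² dX = (∫⁻ |ρ_m|²|Ψ|²).toReal`. [folklore] -/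
theorem integral_weight_sq_eq_toReal (L : ℝ) (m : Fin 3 → ℤ) (Ψ : PeriodicTrialState (n + 1) L) :
    ∫ X in cellN (n + 1) L, ‖∑ j : Fin (n + 1), cellWave L m (X j)‖ ^ 2 * ‖Ψ.ψ X‖ ^ 2 =
      (∫⁻ X in cellN (n + 1) L, ((‖∑ j : Fin (n + 1), cellWave L m (X j)‖₊ : ℝ≥0∞)) ^ 2 *
        (‖Ψ.ψ X‖₊ : ℝ≥0∞) ^ 2).toReal := by
  have hcont : Continuous fun X : Config (n + 1) =>
      ‖∑ j : Fin (n + 1), cellWave L m (X j)‖ ^ 2 * ‖Ψ.ψ X‖ ^ 2 :=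
    ((continuous_densityWaveSum L m).norm.pow 2).mul (Ψ.contDiff.continuous.norm.pow 2)
  rw [integral_eq_lintegral_of_nonneg_ae (Eventually.of_forall fun X => by positivity)
    hcont.aestronglyMeasurable]
  congr 1
  refine lintegral_congr fun X => ?_
  rw [ENNReal.ofReal_mul (by positivity), ENNReal.ofReal_pow (norm_nonneg _),
    ENNReal.ofReal_pow (norm_nonneg _), ofReal_norm, ofReal_norm, enorm_eq_nnnorm, enorm_eq_nnnorm]

/-- `latticeVec c m = c • latticeVec 1 m`. [folklore] -/
theorem latticeVec_eq_smul_one (c : ℝ) (m : Fin 3 → ℤ) : latticeVec c m = c • latticeVec 1 m := by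
  ext k
  simp [latticeVec]

/-- `‖latticeVec c m‖ = c‖latticeVec 1 m‖` for `c ≥ 0`. [folklore] -/
theorem norm_latticeVec_eq_mul (c : ℝ) (hc : 0 ≤ c) (m : Fin 3 → ℤ) :
    ‖latticeVec c m‖ = c * ‖latticeVec 1 m‖ := by
  rw [latticeVec_eq_smul_one c, norm_smul, Real.norm_of_nonneg hc]

/-- A non-zero integer vector has Euclidean norm `≥ 1`. [folklore] -/
theorem one_le_norm_latticeVec_one {m : Fin 3 → ℤ} (hm : m ≠ 0) : 1 ≤ ‖latticeVec 1 m‖ := by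
  obtain ⟨k, hk⟩ : ∃ k, m k ≠ 0 := by
    by_contra h
    push Not at h
    exact hm (funext h)
  have h1 : (1 : ℝ) ≤ |((m k : ℤ) : ℝ)| := by
    rw [← Int.cast_abs, ← Int.cast_one, Int.cast_le]
    exact Int.one_le_abs hk
  have h2 : |((m k : ℤ) : ℝ)| ≤ ‖latticeVec 1 m‖ := by
    have := abs_apply_le_norm_space (latticeVec 1 m) k
    simpa [latticeVec] using this
  exact h1.trans h2

/-- The floor profile `x ↦ x/√(x² + a)` (`a ≥ 0`) is increasing on `(0, ∞)`. [folklore] -/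
theorem div_sqrt_sq_add_mono {a x y : ℝ} (ha : 0 ≤ a) (hx : 0 < x) (hxy : x ≤ y) :
    x / Real.sqrt (x ^ 2 + a) ≤ y / Real.sqrt (y ^ 2 + a) := by
  have hy : 0 < y := hx.trans_le hxy
  rw [div_le_div_iff₀ (Real.sqrt_pos.2 (by positivity)) (Real.sqrt_pos.2 (by positivity))]
  calc x * Real.sqrt (y ^ 2 + a) = Real.sqrt (x ^ 2 * (y ^ 2 + a)) := by
        rw [Real.sqrt_mul (sq_nonneg x), Real.sqrt_sq hx.le]
    _ ≤ Real.sqrt (y ^ 2 * (x ^ 2 + a)) := by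
        refine Real.sqrt_le_sqrt ?_
        have h : a * x ^ 2 ≤ a * y ^ 2 := mul_le_mul_of_nonneg_left (pow_le_pow_left₀ hx.le hxy 2) ha
        nlinarith [h]
    _ = y * Real.sqrt (x ^ 2 + a) := by
        rw [Real.sqrt_mul (sq_nonneg y), Real.sqrt_sq hy.le]

/-- The floor profile decreases in the shift: `x/√(x² + b) ≤ x/√(x² + a)` for `0 ≤ a ≤ b`, `x ≥ 0`.
[folklore] -/
theorem div_sqrt_sq_add_anti {a b x : ℝ} (hx : 0 ≤ x) (hab : a ≤ b) (ha : 0 < x ^ 2 + a) :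
    x / Real.sqrt (x ^ 2 + b) ≤ x / Real.sqrt (x ^ 2 + a) :=
  div_le_div_of_nonneg_left hx (Real.sqrt_pos.2 ha) (Real.sqrt_le_sqrt (by linarith))

/-- `½ min(x/√Θ, 1) ≤ x/√(x² + Θ)` for `x ≥ 0`, `Θ > 0`. [folklore] -/
theorem half_min_le_div_sqrt {x Θ : ℝ} (hx : 0 ≤ x) (hΘ : 0 < Θ) :
    min (x / Real.sqrt Θ) 1 / 2 ≤ x / Real.sqrt (x ^ 2 + Θ) := by
  have hsΘ : 0 < Real.sqrt Θ := Real.sqrt_pos.2 hΘ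
  have hsq : Real.sqrt Θ ^ 2 = Θ := Real.sq_sqrt hΘ.le
  have hden : 0 < Real.sqrt (x ^ 2 + Θ) := Real.sqrt_pos.2 (by positivity)
  rcases le_or_gt x (Real.sqrt Θ) with hle | hlt
  · -- `x ≤ √Θ`: `√(x² + Θ) ≤ 2√Θ`
    have hx2 : x ^ 2 ≤ Θ := by nlinarith
    have h2 : Real.sqrt (x ^ 2 + Θ) ≤ 2 * Real.sqrt Θ := by
      rw [Real.sqrt_le_left (by positivity)]
      nlinarith
    calc min (x / Real.sqrt Θ) 1 / 2 ≤ x / Real.sqrt Θ / 2 := by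
          gcongr; exact min_le_left _ _
      _ = x / (2 * Real.sqrt Θ) := by ring
      _ ≤ x / Real.sqrt (x ^ 2 + Θ) := div_le_div_of_nonneg_left hx hden h2
  · -- `√Θ < x`: `√(x² + Θ) ≤ 2x`
    have hx2 : Θ < x ^ 2 := by nlinarith
    have hxpos : 0 < x := hsΘ.trans hlt
    have h2 : Real.sqrt (x ^ 2 + Θ) ≤ 2 * x := by
      rw [Real.sqrt_le_left (by positivity)]
      nlinarith
    calc min (x / Real.sqrt Θ) 1 / 2 ≤ 1 / 2 := by
          gcongr; exact min_le_right _ _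
      _ = x / (2 * x) := by field_simp
      _ ≤ x / Real.sqrt (x ^ 2 + Θ) := div_le_div_of_nonneg_left hx hden h2

/-- **`√(N S_m)` is `N`-Lipschitz on the unit sphere of `L²(cell^N)`** (specialisation of
`sqrt_toReal_lintegral_weight_sq_le` to the density-wave weight and a phase-rotated comparison state):
`√(∫|ρ_m|²|Ψ|²) ≤ √(∫|ρ_m|²|Φ|²) + N √(∫|Ψ - cΦ|²)` for `|c| = 1`. [folklore] -/
theorem sqrt_weightMoment_le (L : ℝ) (m : Fin 3 → ℤ) (Ψ Φ : PeriodicTrialState (n + 1) L) {c : ℂ}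
    (hc : ‖c‖ = 1) :
    Real.sqrt (∫⁻ X in cellN (n + 1) L, ((‖∑ j : Fin (n + 1), cellWave L m (X j)‖₊ : ℝ≥0∞)) ^ 2 *
        (‖Ψ.ψ X‖₊ : ℝ≥0∞) ^ 2).toReal ≤
      Real.sqrt (∫⁻ X in cellN (n + 1) L, ((‖∑ j : Fin (n + 1), cellWave L m (X j)‖₊ : ℝ≥0∞)) ^ 2 *
        (‖Φ.ψ X‖₊ : ℝ≥0∞) ^ 2).toReal +
      ((n : ℝ) + 1) *
        Real.sqrt (∫⁻ X in cellN (n + 1) L, (‖Ψ.ψ X - c * Φ.ψ X‖₊ : ℝ≥0∞) ^ 2).toReal := by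
  have hw : Measurable fun X : Config (n + 1) =>
      ((‖∑ j : Fin (n + 1), cellWave L m (X j)‖₊ : ℝ≥0∞)) :=
    (continuous_densityWaveSum L m).measurable.nnnorm.coe_nnreal_ennreal
  have hc1 : ((‖c‖₊ : ℝ≥0) : ℝ≥0∞) = 1 := by
    rw [← ENNReal.coe_one, ENNReal.coe_inj, ← NNReal.coe_inj, coe_nnnorm, hc, NNReal.coe_one]
  have hB' : ∫⁻ X in cellN (n + 1) L, ((‖∑ j : Fin (n + 1), cellWave L m (X j)‖₊ : ℝ≥0∞)) ^ 2 *
        (‖c * Φ.ψ X‖₊ : ℝ≥0∞) ^ 2 =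
      ∫⁻ X in cellN (n + 1) L, ((‖∑ j : Fin (n + 1), cellWave L m (X j)‖₊ : ℝ≥0∞)) ^ 2 *
        (‖Φ.ψ X‖₊ : ℝ≥0∞) ^ 2 := by
    refine lintegral_congr fun X => ?_
    rw [nnnorm_mul, ENNReal.coe_mul, mul_pow, hc1, one_pow, one_mul]
  have hBtop : ∫⁻ X in cellN (n + 1) L, ((‖∑ j : Fin (n + 1), cellWave L m (X j)‖₊ : ℝ≥0∞)) ^ 2 *
        (‖c * Φ.ψ X‖₊ : ℝ≥0∞) ^ 2 ≠ ⊤ := by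
    rw [hB']
    exact ne_top_of_le_ne_top (ENNReal.pow_ne_top ENNReal.coe_ne_top) (lintegral_weight_sq_le L m Φ)
  have hcont : Continuous fun X => Ψ.ψ X - c * Φ.ψ X :=
    Ψ.contDiff.continuous.sub (continuous_const.mul Φ.contDiff.continuous)
  have hDtop : ∫⁻ X in cellN (n + 1) L, (‖Ψ.ψ X - c * Φ.ψ X‖₊ : ℝ≥0∞) ^ 2 ≠ ⊤ :=
    (lintegral_cellN_sq_lt_top L hcont).ne
  have h := sqrt_toReal_lintegral_weight_sq_le (volume.restrict (cellN (n + 1) L)) hw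
    (W := ((n + 1 : ℕ) : ℝ≥0)) (coe_nnnorm_densityWaveSum_le L m) (f := Ψ.ψ) (g := fun X => c * Φ.ψ X)
    Ψ.contDiff.continuous.aemeasurable (continuous_const.mul Φ.contDiff.continuous).aemeasurable
    hBtop hDtop
  rw [hB'] at h
  have hcast : (((n + 1 : ℕ) : ℝ≥0) : ℝ) = (n : ℝ) + 1 := by push_cast; ring
  rw [hcast] at h
  exact h

end StructureFactorFloor

end Summit.AtomisticToContinuum.BoseEinsteinCondensation.Theorems

end
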